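import Summits.QuantumFields.YangMills.Theorems.UnitScaleTiltProp7TorusSmoothLength
import HarnessLib

/-!
# Route `UnitScaleTilt`, crux K1 «MinimiserStabilityRegPr» (stmt-QuantumFields-19200), route-R E′ path (α′) — the sup-row residue (hK), row (W3-lite) for the assembly (A), part 2 of 2:
# THE SCALE-ℓ TORUS CUTOFF `χ = S(f∕ℓ − 2)` WITH ALL DIFFERENCE ROWS THROUGH ORDER TWO

Cell `ym3-torus`, D-0154 (3c) twin-width seat `ym-routeR-w2` (gen 5).  THEOREMS ONLY (0 `def`, 0 `sorry`); `--supports stmt-QuantumFields-19200 --as helper`,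
count-neutral.  YM₃ on T³ is a ladder rung (R3), not the Clay problem; nothing here claims the stub, the crux, d = 4 or the gap.

THE POINT (★routeR-w3 g5 19:10:07Z «routeR-w2: (W3-lite) GO»).  The Δ-level peeling (A3′) of the kernel `K(b,·)` needs a cutoff at scale ℓ around the pole with
`0 ≤ χ ≤ 1`, `χ = 1` on `tdist ≤ ℓ`, `χ = 0` far away, `|∂χ| ≲ ℓ⁻¹`, `|∂∂χ|, |Δχ| ≲ ℓ⁻²` — the letters of the commutator `[Δ, χ] = 2∇χ·∇ + (Δχ)`.  Construction:
`χ = S(f∕ℓ − 2)` with the smooth chordal length `f` of ✓ `exists_smooth_length` and the clamped cubic smoothstep `S(u) = p(clamp u)`, `p(v) = 1 − 3v² + 2v³` (a `C^{1,1}` function: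
`|S(u+η) − S(u) − S′(u)η| ≤ 3η²`, `|S′| ≤ 3∕2`, proved by two-line algebra, no calculus).

WHAT IS PROVED (ns `…Theorems.Prop7TorusAgmonWeight`, continued).
* §1 smoothstep letters: `clamp_mem`, `abs_clamp_sub_clamp_le`, `smoothstep_mem`, `abs_smoothstep_sub_le` (`3∕2`-Lipschitz), `smoothstep_taylor_poly` (`p(e) − p(a) − p′(a)(e−a) =
  (e−a)²(4a+2e−3)`), `clamp_defect_le`, ★ `abs_smoothstep_taylor_le` (`|S(u+η) − S(u) − S′(u)η| ≤ 3η²`, `S′(u) = −6·clamp u·(1 − clamp u)`).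
* §2 ★★★ `exists_scale_cutoff (b) (hℓ : 1 ≤ ℓ) : ∃ χ : SiteField P j ℝ, (0 ≤ χ ≤ 1) ∧ (tdist ≤ ℓ → χ = 1) ∧ (5√d·ℓ ≤ tdist → χ = 0) ∧ (|δ^±_μχ| ≤ 3∕(2ℓ)) ∧ (|δ²_μχ| ≤ 9∕ℓ²) ∧
  (|δ_μδ_νχ| ≤ 20∕ℓ², μ ≠ ν) ∧ (∀ c x, |laplace c χ x| ≤ 9·d·c²∕ℓ²)`.
HONEST SCOPE.  Rows through order two only (orders 3–4 for a `Δ²`-level peeling are NOT here, per the GO); constants ours; (A) is not here.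

References: T. Bałaban, CMP 96 (1984) 223–250 [Balaban1984PropagatorsII] ((1.9) p.226).
-/

set_option autoImplicit false

noncomputable section

open scoped BigOperators

namespace Summit.QuantumFields.YangMills.Theorems.Prop7TorusAgmonWeight

open Literature.MathematicalPhysics.QuantumFieldTheory.Balaban1983to89
open LatticeFieldCalculus Finset

/-! ## §1 The clamped cubic smoothstep -/

/-- `0 ≤ clamp u ≤ 1`. [folklore] -/
theorem clamp_mem (u : ℝ) : 0 ≤ max 0 (min u 1) ∧ max 0 (min u 1) ≤ 1 :=
  ⟨le_max_left _ _, max_le zero_le_one (min_le_right _ _)⟩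

/-- the clamp is 1-Lipschitz. [folklore] -/
theorem abs_clamp_sub_clamp_le (u v : ℝ) : |max 0 (min u 1) - max 0 (min v 1)| ≤ |u - v| := by
  have h1 := abs_max_sub_max_le_max (0 : ℝ) (min u 1) 0 (min v 1)
  have h2 := abs_min_sub_min_le_max u 1 v 1
  rw [sub_self, abs_zero] at h1 h2
  have h3 : max 0 |min u 1 - min v 1| = |min u 1 - min v 1| := max_eq_right (abs_nonneg _)
  have h4 : max |u - v| 0 = |u - v| := max_eq_left (abs_nonneg _)
  rw [h3] at h1; rw [h4] at h2
  exact h1.trans h2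

/-- the cubic `p(v) = 1 − 3v² + 2v³` maps `[0,1]` into `[0,1]`. [folklore] -/
theorem smoothstep_mem {v : ℝ} (h0 : 0 ≤ v) (h1 : v ≤ 1) : 0 ≤ 1 - 3 * v ^ 2 + 2 * v ^ 3 ∧ 1 - 3 * v ^ 2 + 2 * v ^ 3 ≤ 1 := by
  constructor
  · have : 1 - 3 * v ^ 2 + 2 * v ^ 3 = (1 - v) ^ 2 * (1 + 2 * v) := by ring
    rw [this]; positivity
  · have : 1 - 3 * v ^ 2 + 2 * v ^ 3 = 1 - v ^ 2 * (3 - 2 * v) := by ring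
    rw [this]; nlinarith [sq_nonneg v]

/-- the cubic is `3∕2`-Lipschitz on `[0,1]`: `p(a) − p(b) = (a−b)(2(a²+ab+b²) − 3(a+b))` and `2(a²+ab+b²) − 3(a+b) + 3∕2 = (a−½)² + (b−½)² + (a+b−1)² ≥ 0`, `≤ 0` on the square. [folklore] -/
theorem abs_smoothstep_sub_le {a b : ℝ} (ha0 : 0 ≤ a) (ha1 : a ≤ 1) (hb0 : 0 ≤ b) (hb1 : b ≤ 1) :
    |(1 - 3 * a ^ 2 + 2 * a ^ 3) - (1 - 3 * b ^ 2 + 2 * b ^ 3)| ≤ 3 / 2 * |a - b| := by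
  have e : (1 - 3 * a ^ 2 + 2 * a ^ 3) - (1 - 3 * b ^ 2 + 2 * b ^ 3) = (a - b) * (2 * (a ^ 2 + a * b + b ^ 2) - 3 * (a + b)) := by ring
  rw [e, abs_mul, mul_comm]
  apply mul_le_mul_of_nonneg_right _ (abs_nonneg _)
  rw [abs_le]
  constructor
  · nlinarith [sq_nonneg (a - 1/2), sq_nonneg (b - 1/2), sq_nonneg (a + b - 1)]
  · nlinarith [mul_nonneg ha0 hb0, mul_nonneg ha0 (by linarith : 0 ≤ 1 - a), mul_nonneg hb0 (by linarith : 0 ≤ 1 - b)]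

/-- the second-order Taylor polynomial identity of the cubic: `p(e) − p(a) − p′(a)(e−a) = (e−a)²(4a + 2e − 3)`, `p′(a) = −6a(1−a)`. [folklore] -/
theorem smoothstep_taylor_poly (a e : ℝ) :
    (1 - 3 * e ^ 2 + 2 * e ^ 3) - (1 - 3 * a ^ 2 + 2 * a ^ 3) - (-6 * a * (1 - a)) * (e - a) = (e - a) ^ 2 * (4 * a + 2 * e - 3) := by ring

/-- the clamping defect: with `a = clamp u`, `e = clamp (u+η)`: `a(1−a)·|η − (e−a)| ≤ |e−a|·(|η| − |e−a|)`. [folklore] -/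
theorem clamp_defect_le (u η : ℝ) :
    max 0 (min u 1) * (1 - max 0 (min u 1)) * |η - (max 0 (min (u + η) 1) - max 0 (min u 1))|
      ≤ |max 0 (min (u + η) 1) - max 0 (min u 1)| * (|η| - |max 0 (min (u + η) 1) - max 0 (min u 1)|) := by
  have hlip : |max 0 (min (u + η) 1) - max 0 (min u 1)| ≤ |η| := by
    have := abs_clamp_sub_clamp_le (u + η) u; rwa [add_sub_cancel_left] at this
  rcases lt_or_ge u 0 with hu | hu
  · -- `u < 0`: `a = 0`
    have ha : max 0 (min u 1) = 0 := max_eq_left (by rw [min_le_iff]; left; exact hu.le)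
    rw [ha]; simp only [zero_mul, mul_one, sub_zero]
    exact mul_nonneg (abs_nonneg _) (by rw [ha, sub_zero] at hlip; linarith)
  rcases lt_or_ge 1 u with hu1 | hu1
  · -- `u > 1`: `a = 1`
    have ha : max 0 (min u 1) = 1 := by rw [min_eq_right hu1.le, max_eq_right zero_le_one]
    rw [ha]; simp only [sub_self, mul_zero, zero_mul]
    exact mul_nonneg (abs_nonneg _) (by rw [ha] at hlip; linarith)
  -- `u ∈ [0,1]`: `a = u`
  have ha : max 0 (min u 1) = u := by rw [min_eq_left hu1, max_eq_right hu]
  rw [ha]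
  rcases lt_or_ge 1 (u + η) with hp | hp
  · -- `u + η > 1`: `e = 1`
    have he : max 0 (min (u + η) 1) = 1 := by rw [min_eq_right hp.le, max_eq_right zero_le_one]
    rw [he]
    have hη : 0 < η := by linarith
    have h1 : |η - (1 - u)| = η - (1 - u) := abs_of_nonneg (by linarith)
    have h2 : |(1 : ℝ) - u| = 1 - u := abs_of_nonneg (by linarith)
    rw [h1, h2, abs_of_pos hη]
    nlinarith [mul_nonneg hu (by linarith : 0 ≤ 1 - u), mul_nonneg (by linarith : 0 ≤ 1 - u) (by linarith : 0 ≤ η - (1 - u))]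
  rcases lt_or_ge (u + η) 0 with hm | hm
  · -- `u + η < 0`: `e = 0`
    have he : max 0 (min (u + η) 1) = 0 := max_eq_left (by rw [min_le_iff]; left; exact hm.le)
    rw [he]
    have hη : η < 0 := by linarith
    have h1 : |η - (0 - u)| = -η - u := by rw [abs_of_nonpos (by linarith)]; ring
    have h2 : |(0 : ℝ) - u| = u := by rw [zero_sub, abs_neg, abs_of_nonneg hu]
    rw [h1, h2, abs_of_neg hη]
    nlinarith [mul_nonneg hu (by linarith : 0 ≤ 1 - u), mul_nonneg hu (by linarith : 0 ≤ -η - u)]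
  · -- both in `[0,1]`: `e − a = η`
    have he : max 0 (min (u + η) 1) = u + η := by rw [min_eq_left hp, max_eq_right hm]
    rw [he, show η - (u + η - u) = 0 by ring, abs_zero, mul_zero]
    exact mul_nonneg (abs_nonneg _) (by rw [he, ha] at hlip; linarith)

/-- ★ **THE SMOOTHSTEP IS `C^{1,1}`**: `|S(u+η) − S(u) − S′(u)·η| ≤ 3η²` with `S(u) = p(clamp u)`, `S′(u) = −6·clamp u·(1 − clamp u)`. [folklore] -/
theorem abs_smoothstep_taylor_le (u η : ℝ) :
    |(1 - 3 * (max 0 (min (u + η) 1)) ^ 2 + 2 * (max 0 (min (u + η) 1)) ^ 3) - (1 - 3 * (max 0 (min u 1)) ^ 2 + 2 * (max 0 (min u 1)) ^ 3)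
      - (-6 * max 0 (min u 1) * (1 - max 0 (min u 1))) * η| ≤ 3 * η ^ 2 := by
  set a := max 0 (min u 1) with ha
  set e := max 0 (min (u + η) 1) with he
  obtain ⟨ha0, ha1⟩ := clamp_mem u
  obtain ⟨he0, he1⟩ := clamp_mem (u + η)
  rw [← ha] at ha0 ha1; rw [← he] at he0 he1
  have hδ : |e - a| ≤ |η| := by
    have := abs_clamp_sub_clamp_le (u + η) u; rwa [add_sub_cancel_left, ← he, ← ha] at this
  have hdef := clamp_defect_le u η
  rw [← ha, ← he] at hdef
  -- split `T = [p(e) − p(a) − p′(a)(e−a)] + p′(a)·((e−a) − η)`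
  have esplit : (1 - 3 * e ^ 2 + 2 * e ^ 3) - (1 - 3 * a ^ 2 + 2 * a ^ 3) - (-6 * a * (1 - a)) * η
      = (e - a) ^ 2 * (4 * a + 2 * e - 3) + 6 * a * (1 - a) * (η - (e - a)) := by
    have := smoothstep_taylor_poly a e; linarith
  rw [esplit]
  have t1 : |(e - a) ^ 2 * (4 * a + 2 * e - 3)| ≤ 3 * (e - a) ^ 2 := by
    rw [abs_mul, abs_of_nonneg (sq_nonneg _), mul_comm]
    apply mul_le_mul_of_nonneg_right _ (sq_nonneg _)
    rw [abs_le]; constructor <;> linarith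
  have t2 : |6 * a * (1 - a) * (η - (e - a))| ≤ 6 * (|e - a| * (|η| - |e - a|)) := by
    rw [show 6 * a * (1 - a) * (η - (e - a)) = 6 * (a * (1 - a) * (η - (e - a))) by ring, abs_mul, abs_of_pos (by norm_num : (0:ℝ) < 6)]
    apply mul_le_mul_of_nonneg_left _ (by norm_num)
    rw [abs_mul, abs_of_nonneg (mul_nonneg ha0 (by linarith))]
    exact hdef
  have hsq : (e - a) ^ 2 = |e - a| ^ 2 := (sq_abs _).symm
  calc |(e - a) ^ 2 * (4 * a + 2 * e - 3) + 6 * a * (1 - a) * (η - (e - a))|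
      ≤ 3 * (e - a) ^ 2 + 6 * (|e - a| * (|η| - |e - a|)) := (abs_add_le _ _).trans (add_le_add t1 t2)
    _ ≤ 3 * η ^ 2 := by
        rw [hsq, ← sq_abs η]; nlinarith [sq_nonneg (|η| - |e - a|), abs_nonneg (e - a)]

/-! ## §2 ★★★ The scale-ℓ cutoff on the torus -/

variable {P : Params} {j : ℕ}

/-- ★★★ **A SCALE-ℓ CUTOFF AROUND A BASE POINT OF `T^{(j)}` WITH DIFFERENCE ROWS THROUGH ORDER TWO**: for `b ∈ T^{(j)}` and `ℓ ≥ 1` there is `χ : T^{(j)} → [0,1]` with `χ = 1` on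
`{tdist(·,b) ≤ ℓ}`, `χ = 0` on `{tdist(·,b) ≥ 5√d·ℓ}`, `|χ(x±e_μ) − χ(x)| ≤ 3∕(2ℓ)`, `|χ(x+e_μ) + χ(x−e_μ) − 2χ(x)| ≤ 9∕ℓ²`,
`|χ(x+e_μ+e_ν) − χ(x+e_μ) − χ(x+e_ν) + χ(x)| ≤ 20∕ℓ²` (`μ ≠ ν`), and `|(laplace c χ)(x)| ≤ 9d·c²∕ℓ²`. [cite: Balaban1984PropagatorsII, (1.9) p.226] -/
theorem exists_scale_cutoff (b : Site P j) {ℓ : ℝ} (hℓ : 1 ≤ ℓ) :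
    ∃ χ : SiteField P j ℝ, (∀ x, 0 ≤ χ x ∧ χ x ≤ 1) ∧
      (∀ x, (Site.tdist x b : ℝ) ≤ ℓ → χ x = 1) ∧
      (∀ x, 5 * Real.sqrt P.d * ℓ ≤ (Site.tdist x b : ℝ) → χ x = 0) ∧
      (∀ x μ, |χ (x.shift μ) - χ x| ≤ 3 / (2 * ℓ) ∧ |χ (x.unshift μ) - χ x| ≤ 3 / (2 * ℓ)) ∧
      (∀ x μ, |χ (x.shift μ) + χ (x.unshift μ) - 2 * χ x| ≤ 9 / ℓ ^ 2) ∧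
      (∀ x μ ν, μ ≠ ν → |χ ((x.shift μ).shift ν) - χ (x.shift μ) - χ (x.shift ν) + χ x| ≤ 20 / ℓ ^ 2) ∧
      (∀ (c : ℝ) x, |laplace c χ x| ≤ 9 * P.d * c ^ 2 / ℓ ^ 2) := by
  classical
  have hℓ0 : 0 < ℓ := by linarith
  obtain ⟨f, hfℓ, hd1, hd2, hmix, hlo, hhi⟩ := exists_smooth_length b hℓ
  -- the cutoff
  set S : ℝ → ℝ := fun u => 1 - 3 * (max 0 (min u 1)) ^ 2 + 2 * (max 0 (min u 1)) ^ 3 with hS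
  set S' : ℝ → ℝ := fun u => -6 * max 0 (min u 1) * (1 - max 0 (min u 1)) with hS'
  have hS01 : ∀ u, 0 ≤ S u ∧ S u ≤ 1 := fun u => by
    obtain ⟨h0, h1⟩ := clamp_mem u; exact smoothstep_mem h0 h1
  have hSlip : ∀ u v, |S u - S v| ≤ 3 / 2 * |u - v| := fun u v => by
    obtain ⟨h0, h1⟩ := clamp_mem u; obtain ⟨k0, k1⟩ := clamp_mem v
    exact (abs_smoothstep_sub_le h0 h1 k0 k1).trans (mul_le_mul_of_nonneg_left (abs_clamp_sub_clamp_le u v) (by norm_num))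
  have hS'le : ∀ u, |S' u| ≤ 3 / 2 := fun u => by
    obtain ⟨h0, h1⟩ := clamp_mem u
    simp only [hS']
    rw [abs_le]; constructor <;> nlinarith [mul_nonneg h0 (by linarith : 0 ≤ 1 - max 0 (min u 1)), sq_nonneg (max 0 (min u 1) - 1/2)]
  have hT : ∀ u η, |S (u + η) - S u - S' u * η| ≤ 3 * η ^ 2 := fun u η => abs_smoothstep_taylor_le u η
  set u : Site P j → ℝ := fun x => f x / ℓ - 2 with hu
  refine ⟨fun x => S (u x), fun x => hS01 _, ?_, ?_, ?_, ?_, ?_, ?_⟩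
  · -- `χ = 1` near `b`
    intro x hx
    have hux : u x ≤ 0 := by
      simp only [hu]; rw [sub_nonpos, div_le_iff₀ hℓ0]; linarith [hhi x]
    show S (u x) = 1
    simp only [hS]; rw [max_eq_left (by rw [min_le_iff]; left; exact hux)]; ring
  · -- `χ = 0` far from `b`
    intro x hx
    have hd : (1 : ℝ) ≤ P.d := by exact_mod_cast P.hd
    have hsd : 1 ≤ Real.sqrt P.d := by rw [Real.le_sqrt (by norm_num) (by linarith)]; linarith
    have hπ : Real.pi < 10 / 3 := by linarith [Real.pi_lt_d2]
    have hfx : 3 * ℓ ≤ f x := by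
      have h1 := hlo x
      have hpos : 0 < Real.pi * Real.sqrt P.d := by positivity
      have : 3 * ℓ ≤ 2 / (Real.pi * Real.sqrt P.d) * (5 * Real.sqrt P.d * ℓ) := by
        rw [div_mul_eq_mul_div, le_div_iff₀ hpos]
        nlinarith [Real.pi_pos, mul_pos (by linarith : (0:ℝ) < Real.sqrt P.d) hℓ0]
      exact this.trans ((mul_le_mul_of_nonneg_left hx (by positivity)).trans h1)
    have hux : 1 ≤ u x := by
      simp only [hu]; rw [le_sub_iff_add_le, le_div_iff₀ hℓ0]; linarith
    show S (u x) = 0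
    simp only [hS]; rw [min_eq_right hux, max_eq_right zero_le_one]; ring
  · -- first differences
    intro x μ
    have e1 : u (x.shift μ) - u x = (f (x.shift μ) - f x) / ℓ := by simp only [hu]; ring
    have e2 : u (x.unshift μ) - u x = (f (x.unshift μ) - f x) / ℓ := by simp only [hu]; ring
    constructor
    · calc |S (u (x.shift μ)) - S (u x)| ≤ 3 / 2 * |u (x.shift μ) - u x| := hSlip _ _
        _ ≤ 3 / 2 * (1 / ℓ) := by
            rw [e1, abs_div, abs_of_pos hℓ0]; gcongr; exact (hd1 x μ).1
        _ = 3 / (2 * ℓ) := by ring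
    · calc |S (u (x.unshift μ)) - S (u x)| ≤ 3 / 2 * |u (x.unshift μ) - u x| := hSlip _ _
        _ ≤ 3 / 2 * (1 / ℓ) := by
            rw [e2, abs_div, abs_of_pos hℓ0]; gcongr; exact (hd1 x μ).2
        _ = 3 / (2 * ℓ) := by ring
  · -- pure second differences
    intro x μ
    set η₁ := u (x.shift μ) - u x with hη₁
    set η₂ := u (x.unshift μ) - u x with hη₂
    have e1 : η₁ = (f (x.shift μ) - f x) / ℓ := by simp only [hη₁, hu]; ring
    have e2 : η₂ = (f (x.unshift μ) - f x) / ℓ := by simp only [hη₂, hu]; ring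
    have hη₁b : |η₁| ≤ 1 / ℓ := by rw [e1, abs_div, abs_of_pos hℓ0]; gcongr; exact (hd1 x μ).1
    have hη₂b : |η₂| ≤ 1 / ℓ := by rw [e2, abs_div, abs_of_pos hℓ0]; gcongr; exact (hd1 x μ).2
    have hsum : |η₁ + η₂| ≤ 2 / ℓ / ℓ := by
      have e : η₁ + η₂ = (f (x.shift μ) + f (x.unshift μ) - 2 * f x) / ℓ := by rw [e1, e2]; ring
      rw [e, abs_div, abs_of_pos hℓ0]; gcongr; exact hd2 x μ
    have key : S (u (x.shift μ)) + S (u (x.unshift μ)) - 2 * S (u x)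
        = (S (u x + η₁) - S (u x) - S' (u x) * η₁) + (S (u x + η₂) - S (u x) - S' (u x) * η₂) + S' (u x) * (η₁ + η₂) := by
      have a1 : u x + η₁ = u (x.shift μ) := by rw [hη₁]; ring
      have a2 : u x + η₂ = u (x.unshift μ) := by rw [hη₂]; ring
      rw [a1, a2]; ring
    rw [key]
    have h1 := hT (u x) η₁
    have h2 := hT (u x) η₂
    have h3 : |S' (u x) * (η₁ + η₂)| ≤ 3 / 2 * (2 / ℓ / ℓ) := by
      rw [abs_mul]; exact mul_le_mul (hS'le _) hsum (abs_nonneg _) (by norm_num)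
    have hη₁2 : η₁ ^ 2 ≤ (1 / ℓ) ^ 2 := by rw [← sq_abs]; exact pow_le_pow_left₀ (abs_nonneg _) hη₁b 2
    have hη₂2 : η₂ ^ 2 ≤ (1 / ℓ) ^ 2 := by rw [← sq_abs]; exact pow_le_pow_left₀ (abs_nonneg _) hη₂b 2
    calc |S (u x + η₁) - S (u x) - S' (u x) * η₁ + (S (u x + η₂) - S (u x) - S' (u x) * η₂) + S' (u x) * (η₁ + η₂)|
        ≤ |S (u x + η₁) - S (u x) - S' (u x) * η₁| + |S (u x + η₂) - S (u x) - S' (u x) * η₂| + |S' (u x) * (η₁ + η₂)| := abs_add_three _ _ _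
      _ ≤ 3 * η₁ ^ 2 + 3 * η₂ ^ 2 + 3 / 2 * (2 / ℓ / ℓ) := add_le_add (add_le_add h1 h2) h3
      _ ≤ 3 * (1 / ℓ) ^ 2 + 3 * (1 / ℓ) ^ 2 + 3 / 2 * (2 / ℓ / ℓ) := by linarith
      _ = 9 / ℓ ^ 2 := by field_simp; ring
  · -- mixed second differences
    intro x μ ν hμν
    set η₁₁ := u ((x.shift μ).shift ν) - u x with hη₁₁
    set η₁ := u (x.shift μ) - u x with hη₁
    set η₂ := u (x.shift ν) - u x with hη₂
    have e1 : η₁ = (f (x.shift μ) - f x) / ℓ := by simp only [hη₁, hu]; ring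
    have e2 : η₂ = (f (x.shift ν) - f x) / ℓ := by simp only [hη₂, hu]; ring
    have e11 : η₁₁ = ((f ((x.shift μ).shift ν) - f (x.shift μ)) + (f (x.shift μ) - f x)) / ℓ := by simp only [hη₁₁, hu]; ring
    have hη₁b : |η₁| ≤ 1 / ℓ := by rw [e1, abs_div, abs_of_pos hℓ0]; gcongr; exact (hd1 x μ).1
    have hη₂b : |η₂| ≤ 1 / ℓ := by rw [e2, abs_div, abs_of_pos hℓ0]; gcongr; exact (hd1 x ν).1
    have hη₁₁b : |η₁₁| ≤ 2 / ℓ := by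
      rw [e11, abs_div, abs_of_pos hℓ0, div_le_div_iff_of_pos_right hℓ0]
      exact (abs_add_le _ _).trans (by linarith [(hd1 (x.shift μ) ν).1, (hd1 x μ).1])
    have hmixu : |η₁₁ - η₁ - η₂| ≤ 1 / ℓ / ℓ := by
      have e : η₁₁ - η₁ - η₂ = (f ((x.shift μ).shift ν) - f (x.shift μ) - f (x.shift ν) + f x) / ℓ := by
        simp only [hη₁₁, hη₁, hη₂, hu]; ring
      rw [e, abs_div, abs_of_pos hℓ0]; gcongr; exact hmix x μ ν hμν
    have key : S (u ((x.shift μ).shift ν)) - S (u (x.shift μ)) - S (u (x.shift ν)) + S (u x)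
        = (S (u x + η₁₁) - S (u x) - S' (u x) * η₁₁) - (S (u x + η₁) - S (u x) - S' (u x) * η₁)
          - (S (u x + η₂) - S (u x) - S' (u x) * η₂) + S' (u x) * (η₁₁ - η₁ - η₂) := by
      have a0 : u x + η₁₁ = u ((x.shift μ).shift ν) := by rw [hη₁₁]; ring
      have a1 : u x + η₁ = u (x.shift μ) := by rw [hη₁]; ring
      have a2 : u x + η₂ = u (x.shift ν) := by rw [hη₂]; ring
      rw [a0, a1, a2]; ring
    rw [key]
    have h0 := hT (u x) η₁₁
    have h1 := hT (u x) η₁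
    have h2 := hT (u x) η₂
    have h3 : |S' (u x) * (η₁₁ - η₁ - η₂)| ≤ 3 / 2 * (1 / ℓ / ℓ) := by
      rw [abs_mul]; exact mul_le_mul (hS'le _) hmixu (abs_nonneg _) (by norm_num)
    have q0 : η₁₁ ^ 2 ≤ (2 / ℓ) ^ 2 := by rw [← sq_abs]; exact pow_le_pow_left₀ (abs_nonneg _) hη₁₁b 2
    have q1 : η₁ ^ 2 ≤ (1 / ℓ) ^ 2 := by rw [← sq_abs]; exact pow_le_pow_left₀ (abs_nonneg _) hη₁b 2
    have q2 : η₂ ^ 2 ≤ (1 / ℓ) ^ 2 := by rw [← sq_abs]; exact pow_le_pow_left₀ (abs_nonneg _) hη₂b 2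
    have tri : ∀ A B C D : ℝ, |A - B - C + D| ≤ |A| + |B| + |C| + |D| := by
      intro A B C D
      calc |A - B - C + D| = |A + (-B) + (-C) + D| := by ring_nf
        _ ≤ |A + (-B) + (-C)| + |D| := abs_add_le _ _
        _ ≤ |A| + |-B| + |-C| + |D| := by linarith [abs_add_three A (-B) (-C)]
        _ = |A| + |B| + |C| + |D| := by rw [abs_neg, abs_neg]
    calc |S (u x + η₁₁) - S (u x) - S' (u x) * η₁₁ - (S (u x + η₁) - S (u x) - S' (u x) * η₁)
          - (S (u x + η₂) - S (u x) - S' (u x) * η₂) + S' (u x) * (η₁₁ - η₁ - η₂)|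
        ≤ |S (u x + η₁₁) - S (u x) - S' (u x) * η₁₁| + |S (u x + η₁) - S (u x) - S' (u x) * η₁|
          + |S (u x + η₂) - S (u x) - S' (u x) * η₂| + |S' (u x) * (η₁₁ - η₁ - η₂)| := tri _ _ _ _
      _ ≤ 3 * η₁₁ ^ 2 + 3 * η₁ ^ 2 + 3 * η₂ ^ 2 + 3 / 2 * (1 / ℓ / ℓ) := add_le_add (add_le_add (add_le_add h0 h1) h2) h3
      _ ≤ 3 * (2 / ℓ) ^ 2 + 3 * (1 / ℓ) ^ 2 + 3 * (1 / ℓ) ^ 2 + 3 / 2 * (1 / ℓ / ℓ) := by linarith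
      _ ≤ 20 / ℓ ^ 2 := by
          have : (0:ℝ) < ℓ ^ 2 := by positivity
          field_simp; nlinarith
  · -- the Laplacian row
    intro c x
    rw [laplace]
    have hterm : ∀ μ : Fin P.d, |c ^ 2 • (S (u x) + S (u x) - S (u (x.shift μ)) - S (u (x.unshift μ)))| ≤ c ^ 2 * (9 / ℓ ^ 2) := by
      intro μ
      rw [smul_eq_mul, abs_mul, abs_of_nonneg (sq_nonneg c)]
      apply mul_le_mul_of_nonneg_left _ (sq_nonneg c)
      have e : S (u x) + S (u x) - S (u (x.shift μ)) - S (u (x.unshift μ)) = -(S (u (x.shift μ)) + S (u (x.unshift μ)) - 2 * S (u x)) := by ring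
      rw [e, abs_neg]
      -- reuse the pure second-difference row just proved?  We re-derive it from `hT` quickly:
      set η₁ := u (x.shift μ) - u x with hη₁
      set η₂ := u (x.unshift μ) - u x with hη₂
      have e1 : η₁ = (f (x.shift μ) - f x) / ℓ := by simp only [hη₁, hu]; ring
      have e2 : η₂ = (f (x.unshift μ) - f x) / ℓ := by simp only [hη₂, hu]; ring
      have hη₁b : |η₁| ≤ 1 / ℓ := by rw [e1, abs_div, abs_of_pos hℓ0]; gcongr; exact (hd1 x μ).1
      have hη₂b : |η₂| ≤ 1 / ℓ := by rw [e2, abs_div, abs_of_pos hℓ0]; gcongr; exact (hd1 x μ).2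
      have hsum : |η₁ + η₂| ≤ 2 / ℓ / ℓ := by
        have e' : η₁ + η₂ = (f (x.shift μ) + f (x.unshift μ) - 2 * f x) / ℓ := by rw [e1, e2]; ring
        rw [e', abs_div, abs_of_pos hℓ0]; gcongr; exact hd2 x μ
      have key : S (u (x.shift μ)) + S (u (x.unshift μ)) - 2 * S (u x)
          = (S (u x + η₁) - S (u x) - S' (u x) * η₁) + (S (u x + η₂) - S (u x) - S' (u x) * η₂) + S' (u x) * (η₁ + η₂) := by
        have a1 : u x + η₁ = u (x.shift μ) := by rw [hη₁]; ring
        have a2 : u x + η₂ = u (x.unshift μ) := by rw [hη₂]; ring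
        rw [a1, a2]; ring
      rw [key]
      have h1 := hT (u x) η₁
      have h2 := hT (u x) η₂
      have h3 : |S' (u x) * (η₁ + η₂)| ≤ 3 / 2 * (2 / ℓ / ℓ) := by
        rw [abs_mul]; exact mul_le_mul (hS'le _) hsum (abs_nonneg _) (by norm_num)
      have hη₁2 : η₁ ^ 2 ≤ (1 / ℓ) ^ 2 := by rw [← sq_abs]; exact pow_le_pow_left₀ (abs_nonneg _) hη₁b 2
      have hη₂2 : η₂ ^ 2 ≤ (1 / ℓ) ^ 2 := by rw [← sq_abs]; exact pow_le_pow_left₀ (abs_nonneg _) hη₂b 2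
      calc |S (u x + η₁) - S (u x) - S' (u x) * η₁ + (S (u x + η₂) - S (u x) - S' (u x) * η₂) + S' (u x) * (η₁ + η₂)|
          ≤ |S (u x + η₁) - S (u x) - S' (u x) * η₁| + |S (u x + η₂) - S (u x) - S' (u x) * η₂| + |S' (u x) * (η₁ + η₂)| := abs_add_three _ _ _
        _ ≤ 3 * η₁ ^ 2 + 3 * η₂ ^ 2 + 3 / 2 * (2 / ℓ / ℓ) := add_le_add (add_le_add h1 h2) h3
        _ ≤ 3 * (1 / ℓ) ^ 2 + 3 * (1 / ℓ) ^ 2 + 3 / 2 * (2 / ℓ / ℓ) := by linarith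
        _ = 9 / ℓ ^ 2 := by field_simp; ring
    calc |∑ μ : Fin P.d, c ^ 2 • (S (u x) + S (u x) - S (u (x.shift μ)) - S (u (x.unshift μ)))|
        ≤ ∑ μ : Fin P.d, |c ^ 2 • (S (u x) + S (u x) - S (u (x.shift μ)) - S (u (x.unshift μ)))| := Finset.abs_sum_le_sum_abs _ _
      _ ≤ ∑ _μ : Fin P.d, c ^ 2 * (9 / ℓ ^ 2) := Finset.sum_le_sum fun μ _ => hterm μ
      _ = 9 * P.d * c ^ 2 / ℓ ^ 2 := by rw [Finset.sum_const, Finset.card_univ, Fintype.card_fin, nsmul_eq_mul]; ring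

end Summit.QuantumFields.YangMills.Theorems.Prop7TorusAgmonWeight

end
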